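import Mathlib
import Summits.Ventures.PercRepro2.Defs
import Summits.Ventures.PercRepro2.Harris
import Summits.Ventures.PercRepro2.Graph
import Summits.Ventures.PercRepro2.WForm
import Summits.Ventures.PercRepro2.WStatus
import Summits.Ventures.PercRepro2.WBern
import Summits.Ventures.PercRepro2.TypedBases
import Summits.Ventures.PercRepro2.CompHarris
import Summits.Ventures.PercRepro2.WBernTwo
import Summits.Ventures.PercRepro2.WTwo

/-!
# Two test vertices and ANY avoided set: the W-inequality is the two-point inequality
(blind cell PercRepro2, mine-1 g14; proofs/MINE1-WBERN.md §13)

`WTwo.lean` proved the W-inequality of the status law for `F = {x, y}` and `T = ∅`. The closed form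
`Q_status_two` holds for every avoided set `T`, and the layer-cake argument of `wIneqStatus_two` uses
only the two-point inequality `Wₓ W_y ≤ W∅ W_{xy}` — so for every `T`:
`WIneqStatus p ends s T {x, y} ↔ statusW {x} · statusW {y} ≤ statusW ∅ · statusW {x, y}`
(`wIneqStatus_two_iff`). Row 2′W at `|F| = 2` is therefore EXACTLY the two-point inequality with an
avoided set, `P(C ∩ {x,y} = {x}, C ∩ T = ∅) · P(C ∩ {x,y} = {y}, C ∩ T = ∅) ≤
P(C ∩ {x,y} = ∅, C ∩ T = ∅) · P(C ⊇ {x,y}, C ∩ T = ∅)` — proved for `T = ∅` (`WTwo.lean`), open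
(census-true through `n = 6`, every single-vertex `T`) otherwise.
-/

namespace Summit.Ventures.PercRepro2

section TwoPointIff

variable {V : Type*} {E : Type*} [Fintype E] [DecidableEq E] [Fintype V] [DecidableEq V]
  {R : Type*} [Field R] [LinearOrder R] [IsStrictOrderedRing R]

variable (p : E → R) (ends : E → Sym2 V) (s : V) (T : Finset V)

omit [Fintype E] [DecidableEq E] [Fintype V] in
/-- The indicator of «`x ∈ S`» is monotone on finsets. -/
lemma monotone_mem_indicator (x : V) :
    Monotone (fun S : Finset V => if x ∈ S then (1 : R) else 0) := by
  intro S S' hSS'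
  by_cases hx : x ∈ S
  · simp only [if_pos hx, if_pos (hSS' hx), le_refl]
  · simp only [if_neg hx]
    split_ifs <;> norm_num

/-- **The two-point inequality from the W-inequality** (any avoided set): evaluating the W-form on the
principal pair `g = 1_{x ∈ ·}`, `h = 1_{y ∈ ·}` through the closed form `Q_status_two`. -/
theorem statusW_two_mul_le_of_wIneqStatus (x y : V) (hxy : x ≠ y)
    (h : WIneqStatus p ends s T {x, y}) :
    statusW p ends s T {x, y} {x} * statusW p ends s T {x, y} {y} ≤
      statusW p ends s T {x, y} ∅ * statusW p ends s T {x, y} {x, y} := by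
  have hQ := h.2 (fun S => if x ∈ S then (1 : R) else 0) (fun S => if y ∈ S then (1 : R) else 0)
    (monotone_mem_indicator x) (monotone_mem_indicator y)
  rw [Q_status_two p ends s T x y hxy] at hQ
  have hyx : y ≠ x := hxy.symm
  simp only [Finset.mem_singleton, Finset.mem_insert, Finset.notMem_empty, hxy, hyx,
    if_true, if_false, or_true, or_false, sub_zero, sub_self,
    mul_zero, mul_one, one_mul, add_zero, zero_add] at hQ
  linarith

/-- **The W-inequality from the two-point inequality** (any avoided set): the layer-cake argument of
`WTwo.wIneqStatus_two` verbatim, with `T` in place of `∅`. -/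
theorem wIneqStatus_two_of_mul_le (hp : IsProbVec p) (x y : V) (hxy : x ≠ y)
    (key : statusW p ends s T {x, y} {x} * statusW p ends s T {x, y} {y} ≤
      statusW p ends s T {x, y} ∅ * statusW p ends s T {x, y} {x, y}) :
    WIneqStatus p ends s T {x, y} := by
  have hW : ∀ S, 0 ≤ statusW p ends s T {x, y} S := statusW_nonneg ends s T {x, y} hp
  have h0x := mul_nonneg (hW ∅) (hW {x})
  have h0y := mul_nonneg (hW ∅) (hW {y})
  have hxy' := mul_nonneg (hW {x}) (hW {y})
  have hkey : 0 ≤ statusW p ends s T {x, y} ∅ * statusW p ends s T {x, y} {x, y} -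
      statusW p ends s T {x, y} {x} * statusW p ends s T {x, y} {y} := sub_nonneg.mpr key
  refine WForm.wIneq_of_upperSets hW ?_
  intro U V hU hV
  rw [Q_status_two p ends s T x y hxy]
  have hU1 : (WForm.ind U ∅ : R) ≤ WForm.ind U {x} :=
    ind_le_ind U fun h => hU (Finset.empty_subset _) h
  have hU2 : (WForm.ind U ∅ : R) ≤ WForm.ind U {y} :=
    ind_le_ind U fun h => hU (Finset.empty_subset _) h
  have hU3 : (WForm.ind U {x} : R) ≤ WForm.ind U {x, y} :=
    ind_le_ind U fun h => hU (Finset.singleton_subset_iff.mpr (Finset.mem_insert_self x {y})) h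
  have hU4 : (WForm.ind U {y} : R) ≤ WForm.ind U {x, y} :=
    ind_le_ind U fun h => hU (Finset.subset_insert x {y}) h
  have hV1 : (WForm.ind V ∅ : R) ≤ WForm.ind V {x} :=
    ind_le_ind V fun h => hV (Finset.empty_subset _) h
  have hV2 : (WForm.ind V ∅ : R) ≤ WForm.ind V {y} :=
    ind_le_ind V fun h => hV (Finset.empty_subset _) h
  have hV3 : (WForm.ind V {x} : R) ≤ WForm.ind V {x, y} :=
    ind_le_ind V fun h => hV (Finset.singleton_subset_iff.mpr (Finset.mem_insert_self x {y})) h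
  have hV4 : (WForm.ind V {y} : R) ≤ WForm.ind V {x, y} :=
    ind_le_ind V fun h => hV (Finset.subset_insert x {y}) h
  have hcm : (0 : R) ≤ (WForm.ind U {x, y} - WForm.ind U ∅) - (WForm.ind U {x} - WForm.ind U {y}) := by
    linarith
  have hcp : (0 : R) ≤ (WForm.ind U {x, y} - WForm.ind U ∅) + (WForm.ind U {x} - WForm.ind U {y}) := by
    linarith
  have hcm' : (0 : R) ≤ (WForm.ind V {x, y} - WForm.ind V ∅) - (WForm.ind V {x} - WForm.ind V {y}) := by
    linarith
  have hcp' : (0 : R) ≤ (WForm.ind V {x, y} - WForm.ind V ∅) + (WForm.ind V {x} - WForm.ind V {y}) := by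
    linarith
  have hCD : (0 : R) ≤ (WForm.ind U {x, y} - WForm.ind U ∅) * (WForm.ind V {x, y} - WForm.ind V ∅) +
      (WForm.ind U {x} - WForm.ind U {y}) * (WForm.ind V {x} - WForm.ind V {y}) := by
    nlinarith [mul_nonneg hcm hcm', mul_nonneg hcp hcp']
  have hA : (0 : R) ≤ (WForm.ind U {x} - WForm.ind U ∅) * (WForm.ind V {x} - WForm.ind V ∅) :=
    mul_nonneg (sub_nonneg.mpr hU1) (sub_nonneg.mpr hV1)
  have hB : (0 : R) ≤ (WForm.ind U {y} - WForm.ind U ∅) * (WForm.ind V {y} - WForm.ind V ∅) :=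
    mul_nonneg (sub_nonneg.mpr hU2) (sub_nonneg.mpr hV2)
  have hC : (0 : R) ≤ (WForm.ind U {x, y} - WForm.ind U ∅) * (WForm.ind V {x, y} - WForm.ind V ∅) :=
    mul_nonneg (sub_nonneg.mpr (hU1.trans hU3)) (sub_nonneg.mpr (hV1.trans hV3))
  nlinarith [mul_nonneg h0x hA, mul_nonneg h0y hB, mul_nonneg hkey hC, mul_nonneg hxy' hCD]

/-- **Row 2′W at `|F| = 2` is exactly the two-point inequality with an avoided set**:
`WIneqStatus p ends s T {x, y} ↔ Wₓ W_y ≤ W∅ W_{xy}` for every admissible `p` and every `T`. -/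
theorem wIneqStatus_two_iff (hp : IsProbVec p) (x y : V) (hxy : x ≠ y) :
    WIneqStatus p ends s T {x, y} ↔
      statusW p ends s T {x, y} {x} * statusW p ends s T {x, y} {y} ≤
        statusW p ends s T {x, y} ∅ * statusW p ends s T {x, y} {x, y} :=
  ⟨statusW_two_mul_le_of_wIneqStatus p ends s T x y hxy,
    wIneqStatus_two_of_mul_le p ends s T hp x y hxy⟩

end TwoPointIff

end Summit.Ventures.PercRepro2
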